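import Literature.MathematicalPhysics.QuantumFieldTheory.Balaban1983to89.B15DeterminingSetsB
import Literature.MathematicalPhysics.QuantumFieldTheory.Balaban1983to89.B14Eq213DetSet
import Literature.MathematicalPhysics.QuantumFieldTheory.Balaban1983to89.B15Eq177GaugeInvariance
import Literature.MathematicalPhysics.QuantumFieldTheory.Balaban1983to89.B10StarCount

/-!
# `Balaban1983to89.B15DeterminingSetsBEndpoints` — [Balaban1984PropagatorsII] = «[II]», (2.3) p. 224 (*«Λ_j = Ω_j^{(j)} ∖ Ω_{j+1}^{(j)} … for the sets of sites and
# the sets of bonds»*); [Balaban1988Convergent] = «[III]», (2.2) p. 255, (2.13) pp. 256–257; [Balaban1987RG1] = «[I]», (0.1)–(0.3) pp. 251–252 (blocks):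
# EVERY SITE OF `Γ_j^{(j)}` IS AN END-POINT OF A BOND OF PRINT's `Λ_j` — the end-point cover of the [II] (2.3) bond datum (companion of F0a `B15DeterminingSetsB` §4)

Honest framing: statement-level skeleton of published theorems with citation tags; proofs where landed; nothing here is a claim about the
Yang–Mills mass gap.  Cell `pub-ymgap`, seat `pub-ymgap-dag-n12-c` (g36; LANE OWNER N12 = [B15], strategy s1); count-neutral helper of K1⁹ (`stmt-QuantumFields-27364`);
N12 NOT discharged; finite 𝕋⁴ at fixed ε; nothing continuum ∕ OS ∕ mass-gap ∕ Clay.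

WHY (the (E1)(iii-b) re-attachment at print's [II] (2.3) datum, director-ym №338–№358).  Over the BOND-level datum `𝔅 = lamBondsSeq Ω k` the root points of the tower forest are the
block-tower sites of the END-POINTS OF THE MEMBERS `c ∈ 𝔅 j` (dag-n12-w6 CLAIM-7 `R(𝔅, k)`; the lane's ✓`B15Prop1GaugeLetterLocOfForestPackageB`), and the covering clause (Cov) of the forest
package reads «every site has a level `J ≤ k` and a MEMBER `c ∈ 𝔅 J` of which `B^J z` is an end-point».  At the site level the tree already knows that the `Γ_j` cover the torus scale by
scale; this file supplies the missing bond-level step: a `j`-site of `Γ_j^{(j)}` is an end-point of a bond of `Λ_j` — print's `Λ_j` omits only the INWARD connectors (an end-point whose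
`(j+1)`-block is a `(j+1)`-point of `Ω_{j+1}`), and every `j`-site has a lattice neighbour INSIDE ITS OWN `(j+1)`-block (`L ≥ 2`), so the bond to that neighbour is never an inward connector
when `Ω_{j+1}` is a union of `(j+1)`-blocks ([III] (2.13)).  In particular every fine site off `Ω₁` is an end-point of a `Λ₀`-bond — a ROOT of the tower-axial gauge at print's datum
(the lane's LOCATED-2: crossing bonds have exactly one root end-point).

CONTENTS (theorems only; no `def`, no `instance`, no `sorry`; namespace `…B15DeterminingSetsBEndpoints`).
* §1 ★ `exists_adj_blockOf_eq` — every `j`-site (`j + 1 ≤ m + K`) has a lattice neighbour in the same `(j+1)`-block ([I] (0.3); `L ≥ 2`).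
* §2 ★★ `exists_mem_lamBondsSeq_of_mem_genSet` — every site of `Γ_j^{(j)}` (`j ≤ k ≤ m + K`; `Ω_{j+1}` a union of `(j+1)`-blocks when `j < k`) is an end-point of a bond of `Λ_j`;
  `exists_mem_lamBondsSeq_zero_of_not_mem` (level `0`: every fine site off `Ω₁` is an end-point of a `Λ₀`-bond); ★★ `exists_mem_lamBondsSeq_maxDomT_of_mem_Bj` (at `Z`'s maximal sequence:
  every site of `𝐁_k(Z)_j` is an end-point of a member of `lamBondsSeq (maxDomT M₁ Z) k j`) and the (Cov) transfer `cover_lamBondsSeq_maxDomT_of_cover_Bj`.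
HONEST SCOPE: lattice bookkeeping; nothing of Bałaban's estimates asserted; count-neutral; N12 NOT discharged; the YM mass gap (Clay) is NOT proved by any of this — R4 closes only the
conditional finite-𝕋⁴ rung `BalabanLadder.UV`.
-/

noncomputable section

namespace Literature.MathematicalPhysics.QuantumFieldTheory.Balaban1983to89.B15DeterminingSetsBEndpoints

open B15DeterminingSets B15DeterminingSetsB
open B10StarCount (shift_apply_self shift_unshift unshift_shift blockOf_shift)
open B14.Eq22Determines (blockIter blockIter_succ IsBlockUnion mem_iff_blockIter_mem_pts)
open B14.Eq213DetSet (Bj maxDomT isBlockUnion_maxDomT)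
open B15Eq177GaugeInvariance (blockIter_embIter)

variable {P : Params}

/-! ## §1  A lattice neighbour inside the same block -/

/-- ★ **EVERY `j`-SITE HAS A LATTICE NEIGHBOUR IN ITS OWN `(j+1)`-BLOCK** (`j + 1 ≤ m + K`, `L ≥ 2`): along the first axis, the forward neighbour unless the site lies on the top layer of
its block, the backward neighbour otherwise ([I] (0.3): a block is `L` consecutive labels per direction; `B10StarCount.blockOf_shift`). [cite: Balaban1987RG1, (0.3) p.252] -/
theorem exists_adj_blockOf_eq {j : ℕ} (hj : j + 1 ≤ P.m + P.K) (y : Site P j) :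
    ∃ (μ : Fin P.d) (y' : Site P j), (y' = y.shift μ ∨ y = y'.shift μ) ∧ blockOf y' = blockOf y := by
  have hL1 : 1 < P.L := P.hL.2
  set μ : Fin P.d := ⟨0, P.hd⟩
  by_cases h : (y μ).val % P.L + 1 = P.L
  · -- top layer: step backwards; the backward neighbour is not on the top layer
    refine ⟨μ, y.unshift μ, Or.inr (shift_unshift y μ).symm, ?_⟩
    have key := blockOf_shift hj (y.unshift μ) μ
    rw [shift_unshift] at key
    rw [key, if_neg]
    -- the label of `y − e_μ` in direction `μ` is `v − 1`, of residue `L − 2`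
    haveI : Fact (1 < P.sitesPerDir j) := ⟨by
      have h1 : 1 ≤ P.L ^ (P.m + P.K - j) := Nat.one_le_pow _ _ P.L_pos
      unfold Params.sitesPerDir; omega⟩
    set v : ℕ := (y μ).val with hv
    have hvmod : v % P.L = P.L - 1 := by omega
    have hv1 : 1 ≤ v := by
      have := Nat.mod_le v P.L
      omega
    have hy' : (y.unshift μ) μ = y μ - 1 := by simp [Site.unshift]
    have hval : ((y.unshift μ) μ).val = v - 1 := by
      rw [hy', ZMod.val_sub (by rw [ZMod.val_one]; exact hv1), ZMod.val_one]
    have hdm : P.L * (v / P.L) + v % P.L = v := Nat.div_add_mod v P.L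
    have hrepr : v - 1 = (P.L - 2) + P.L * (v / P.L) := by omega
    have hres : (v - 1) % P.L = P.L - 2 := by
      rw [hrepr, Nat.add_mul_mod_self_left, Nat.mod_eq_of_lt (by omega)]
    rw [hval, hres]
    omega
  · exact ⟨μ, y.shift μ, Or.inl rfl, by rw [blockOf_shift hj, if_neg h]⟩

/-! ## §2  Every site of `Γ_j^{(j)}` is an end-point of a bond of `Λ_j` -/

/-- ★★ **END-POINT COVER OF PRINT's [II] (2.3) DATUM**: for `j ≤ k ≤ m + K`, with `Ω_{j+1}` a union of `(j+1)`-blocks when `j < k`, every `j`-site `y ∈ Γ_j^{(j)}` (`genSet Ω k j`) is an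
end-point of a bond `c ∈ Λ_j` (`lamBondsSeq Ω k j`).  Proof: the bond between `y` and a neighbour `y′` in the same `(j+1)`-block meets `Γ_j^{(j)}` at `y`; for `j < k` neither end-point is deep
in `Ω_{j+1}`: the `(j+1)`-block of `y` (= that of `y′`) being a `(j+1)`-point of the block union `Ω_{j+1}` would put the centre of `y` in `Ω_{j+1}`, against `y ∈ Γ_j^{(j)}` (`Γ₀ = Ω₁ᶜ`,
`Γ_j = Ω_j ∖ Ω_{j+1}`).  At the top level there is no exclusion. [cite: Balaban1984PropagatorsII, (2.3) p.224; Balaban1988Convergent, (2.2) p.255, (2.13) pp.256–257; Balaban1987RG1, (0.3) p.252] -/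
theorem exists_mem_lamBondsSeq_of_mem_genSet (Ω : ℕ → Set (Site P 0)) {k : ℕ} (hk : k ≤ P.m + P.K) {j : ℕ}
    (hΩ : j < k → IsBlockUnion (j + 1) (Ω (j + 1))) {y : Site P j} (hy : y ∈ genSet Ω k j) :
    ∃ c ∈ lamBondsSeq Ω k j, c.src = y ∨ c.tgt = y := by
  by_cases hjk : j < k
  · have hj : j + 1 ≤ P.m + P.K := by omega
    obtain ⟨μ, y', hadj, hblk⟩ := exists_adj_blockOf_eq hj y
    -- the centre of `y` is not in `Ω_{j+1}`
    have hnot : embIter j y ∉ Ω (j + 1) := by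
      have hy' : embIter j y ∈ gammaRegion Ω k j := mem_pts.1 hy
      rcases Nat.eq_zero_or_pos j with hj0 | hjpos
      · subst hj0
        rw [gammaRegion_zero Ω hjk] at hy'
        exact hy'
      · rw [gammaRegion_mid Ω hjpos hjk] at hy'
        exact hy'.2
    -- hence the `(j+1)`-block of `y` is not a `(j+1)`-point of the block union `Ω_{j+1}`
    have hdeep : blockOf y ∉ pts (j + 1) (Ω (j + 1)) := by
      intro hmem
      apply hnot
      rw [mem_iff_blockIter_mem_pts (hΩ hjk) (embIter j y), blockIter_succ, blockIter_embIter j (by omega) y]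
      exact hmem
    rcases hadj with rfl | rfl
    · -- `y′ = y + e_μ`: the bond `⟨y, μ⟩`
      refine ⟨⟨y, μ⟩, ?_, Or.inl rfl⟩
      rw [mem_lamBondsSeq_iff]
      refine ⟨Or.inl hy, fun _ => ⟨hdeep, ?_⟩⟩
      show blockOf (y.shift μ) ∉ pts (j + 1) (Ω (j + 1))
      rw [hblk]; exact hdeep
    · -- `y = y′ + e_μ`: the bond `⟨y′, μ⟩`
      refine ⟨⟨y', μ⟩, ?_, Or.inr rfl⟩
      rw [mem_lamBondsSeq_iff]
      refine ⟨Or.inr hy, fun _ => ⟨?_, hdeep⟩⟩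
      show blockOf y' ∉ pts (j + 1) (Ω (j + 1))
      rw [hblk]; exact hdeep
  · -- top level (or above, vacuously): no exclusion
    exact ⟨⟨y, ⟨0, P.hd⟩⟩, ⟨Or.inl hy, fun h => absurd h hjk⟩, Or.inl rfl⟩

/-- **LEVEL `0`: EVERY FINE SITE OFF `Ω₁` IS AN END-POINT OF A `Λ₀`-BOND** (`0 < k ≤ m + K`, `Ω₁` a union of `1`-blocks) — so at print's datum every site of `Γ₀ = Ω₁ᶜ` is a ROOT POINT of the
tower forest (the `Λ₀`-end of a crossing bond included). [cite: Balaban1984PropagatorsII, (2.3) p.224; Balaban1988Convergent, (2.2) p.255] -/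
theorem exists_mem_lamBondsSeq_zero_of_not_mem (Ω : ℕ → Set (Site P 0)) {k : ℕ} (hk0 : 0 < k) (hk : k ≤ P.m + P.K)
    (hΩ : IsBlockUnion 1 (Ω 1)) {y : Site P 0} (hy : y ∉ Ω 1) :
    ∃ c ∈ lamBondsSeq Ω k 0, c.src = y ∨ c.tgt = y :=
  exists_mem_lamBondsSeq_of_mem_genSet Ω hk (fun _ => hΩ) (by
    show y ∈ pts 0 (gammaRegion Ω k 0)
    rw [gammaRegion_zero Ω hk0, pts_zero]
    exact hy)

/-- ★★ **AT `Z`'s MAXIMAL SEQUENCE** ([III] (2.13): every `Ω_n(Z)` is a union of `n`-blocks, `1 ≤ n ≤ k`, under print's `1 ≤ M₁` and the torus divisibility): every site of the tree's site-level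
member `𝐁_k(Z)_j = Γ_j^{(j)}` is an end-point of a member of print's [II] (2.3) datum `lamBondsSeq (maxDomT M₁ Z) k j` (`j ≤ k ≤ m + K`).
[cite: Balaban1984PropagatorsII, (2.3) p.224; Balaban1988Convergent, (2.2) p.255, (2.13) pp.256–257] -/
theorem exists_mem_lamBondsSeq_maxDomT_of_mem_Bj {M₁ : ℕ} (hM : 1 ≤ M₁) (Z : Set (Site P 0)) {k : ℕ} (hk : k ≤ P.m + P.K)
    (hdiv : B14.Eq213MaximalDomains.side P.L M₁ k ∣ P.sitesPerDir 0) {j : ℕ} {y : Site P j} (hy : y ∈ (Bj M₁ Z k : DetSet P) j) :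
    ∃ c ∈ lamBondsSeq (maxDomT M₁ Z) k j, c.src = y ∨ c.tgt = y :=
  exists_mem_lamBondsSeq_of_mem_genSet (maxDomT M₁ Z) hk
    (fun hjk => isBlockUnion_maxDomT hM hdiv (by omega) (by omega) (by omega)) hy

/-- **(Cov) TRANSFER**: a site-level cover «every fine site `z` has a level `J ≤ k` with `B z ∈ 𝐁_k(Z)_J`» (any block-tower map `B`, e.g. `iterBlockOf`∕`blockIter`) yields the bond-level
cover of print's datum «… and a member `c ∈ lamBondsSeq (maxDomT M₁ Z) k J` of which `B z` is an end-point» — the (Cov) clause of ✓`B15Prop1GaugeLetterLocOfForestPackageB`.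
[cite: Balaban1984PropagatorsII, (2.3) p.224; Balaban1988Convergent, (2.2) p.255, (2.13) pp.256–257] -/
theorem cover_lamBondsSeq_maxDomT_of_cover_Bj {M₁ : ℕ} (hM : 1 ≤ M₁) (Z : Set (Site P 0)) {k : ℕ} (hk : k ≤ P.m + P.K)
    (hdiv : B14.Eq213MaximalDomains.side P.L M₁ k ∣ P.sitesPerDir 0) (B : (J : ℕ) → Site P 0 → Site P J)
    (hcov : ∀ z : Site P 0, ∃ J, J ≤ k ∧ B J z ∈ (Bj M₁ Z k : DetSet P) J) (z : Site P 0) :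
    ∃ J, J ≤ k ∧ ∃ c ∈ lamBondsSeq (maxDomT M₁ Z) k J, (B J z = c.src ∨ B J z = c.tgt) := by
  obtain ⟨J, hJ, hz⟩ := hcov z
  obtain ⟨c, hc, h⟩ := exists_mem_lamBondsSeq_maxDomT_of_mem_Bj hM Z hk hdiv hz
  exact ⟨J, hJ, c, hc, by rcases h with h | h <;> [exact Or.inl h.symm; exact Or.inr h.symm]⟩

/-! ## §3  (v1.1, append-only) Membership at a block-union level reads on the CENTRES: the outward connectors are members -/

/-- **THE CENTRE OF A `Γ_j^{(j)}`-SITE IS NOT IN `Ω_{j+1}`** (`j < k`; `Γ₀ = Ω₁ᶜ`, `Γ_j = Ω_j ∖ Ω_{j+1}`). [cite: Balaban1988Convergent, (2.2) p.255] -/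
theorem embIter_not_mem_succ_of_mem_genSet (Ω : ℕ → Set (Site P 0)) {k j : ℕ} (hjk : j < k) {y : Site P j} (hy : y ∈ genSet Ω k j) :
    embIter j y ∉ Ω (j + 1) := by
  have hy' : embIter j y ∈ gammaRegion Ω k j := mem_pts.1 hy
  rcases Nat.eq_zero_or_pos j with hj0 | hjpos
  · subst hj0
    rw [gammaRegion_zero Ω hjk] at hy'
    exact hy'
  · rw [gammaRegion_mid Ω hjpos hjk] at hy'
    exact hy'.2

/-- **AT A BLOCK-UNION LEVEL THE [II] (2.3) EXCLUSION READS ON THE CENTRES** (`j + 1 ≤ m + K`, `Ω_{j+1}` a union of `(j+1)`-blocks): the `(j+1)`-block of a `j`-site `y` is a `(j+1)`-point of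
`Ω_{j+1}` iff the centre of `y` lies in `Ω_{j+1}` ([III] (2.13); `blockIter_embIter`). [cite: Balaban1984PropagatorsII, (2.3) p.224; Balaban1988Convergent, (2.13) pp.256–257] -/
theorem blockOf_mem_pts_succ_iff {j : ℕ} (hj : j + 1 ≤ P.m + P.K) {X : Set (Site P 0)} (hX : IsBlockUnion (j + 1) X) (y : Site P j) :
    blockOf y ∈ pts (j + 1) X ↔ embIter j y ∈ X := by
  rw [mem_iff_blockIter_mem_pts hX (embIter j y), blockIter_succ, blockIter_embIter j (by omega) y]

/-- ★★ **MEMBERSHIP CRITERION FOR PRINT's `Λ_j` AT A BLOCK-UNION SEQUENCE**: a `j`-bond meeting `Γ_j^{(j)}` none of whose two end-point CENTRES lies in `Ω_{j+1}` (asked only for `j < k`;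
`Ω_{j+1}` a union of `(j+1)`-blocks, `k ≤ m + K`) is a bond of `Λ_j` — in particular every OUTWARD connector (from `Γ_j^{(j)}` to a block whose centre is off `Ω_{j+1}`, e.g. off `Ω_j`) is a
member; only the INWARD connectors are dropped.  The level-`0` case at `Z`'s maximal sequence is the lane's `B15Prop1GradientFromNearValue.mem_lamDatumP_maxDomT_zero_of_not_mem₂`.
[cite: Balaban1984PropagatorsII, (2.3) p.224; Balaban1988Convergent, (2.2) p.255, (2.13) pp.256–257] -/
theorem mem_lamBondsSeq_of_embIter_not_mem (Ω : ℕ → Set (Site P 0)) {k : ℕ} (hk : k ≤ P.m + P.K) {j : ℕ}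
    (hΩ : j < k → IsBlockUnion (j + 1) (Ω (j + 1))) {c : PBond P j} (hc : c ∈ bondsOf (genSet Ω k j))
    (hs : j < k → embIter j c.src ∉ Ω (j + 1)) (ht : j < k → embIter j c.tgt ∉ Ω (j + 1)) : c ∈ lamBondsSeq Ω k j := by
  rw [mem_lamBondsSeq_iff]
  refine ⟨hc, fun hjk => ⟨?_, ?_⟩⟩
  · rw [blockOf_mem_pts_succ_iff (by omega) (hΩ hjk) c.src]; exact hs hjk
  · rw [blockOf_mem_pts_succ_iff (by omega) (hΩ hjk) c.tgt]; exact ht hjk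

/-- Conversely, the end-point centres of a member of `Λ_j` (`j < k`, block-union level) lie off `Ω_{j+1}`. [cite: Balaban1984PropagatorsII, (2.3) p.224; Balaban1988Convergent, (2.13) pp.256–257] -/
theorem embIter_not_mem_of_mem_lamBondsSeq (Ω : ℕ → Set (Site P 0)) {k : ℕ} (hk : k ≤ P.m + P.K) {j : ℕ} (hjk : j < k)
    (hΩ : IsBlockUnion (j + 1) (Ω (j + 1))) {c : PBond P j} (hc : c ∈ lamBondsSeq Ω k j) :
    embIter j c.src ∉ Ω (j + 1) ∧ embIter j c.tgt ∉ Ω (j + 1) := by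
  obtain ⟨hs, ht⟩ := ((mem_lamBondsSeq_iff Ω k c).1 hc).2 hjk
  exact ⟨fun h => hs ((blockOf_mem_pts_succ_iff (by omega) hΩ c.src).2 h), fun h => ht ((blockOf_mem_pts_succ_iff (by omega) hΩ c.tgt).2 h)⟩

/-- ★ **OUTWARD CONNECTORS ARE MEMBERS**: a `j`-bond whose source is a `Γ_j^{(j)}`-site and whose target's centre is off `Ω_{j+1}` (when `j < k`) belongs to `Λ_j` — the link a
crossing bond's transporter runs through (the lane's LOCATED-2: from the `Γ₁`-block of the `Ω₁`-end to the block of the `Λ₀`-end); the mirror statement for the target. At `Z`'s maximal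
sequence `Ω_{j+1}(Z) ⊆ Ω_j(Z)`, so «centre off `Ω_j`» suffices. [cite: Balaban1984PropagatorsII, (2.3) p.224; Balaban1988Convergent, (2.2) p.255, (2.13) pp.256–257] -/
theorem mem_lamBondsSeq_of_src_mem_genSet (Ω : ℕ → Set (Site P 0)) {k : ℕ} (hk : k ≤ P.m + P.K) {j : ℕ}
    (hΩ : j < k → IsBlockUnion (j + 1) (Ω (j + 1))) {c : PBond P j} (hsrc : c.src ∈ genSet Ω k j)
    (ht : j < k → embIter j c.tgt ∉ Ω (j + 1)) : c ∈ lamBondsSeq Ω k j :=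
  mem_lamBondsSeq_of_embIter_not_mem Ω hk hΩ (Or.inl hsrc) (fun hjk => embIter_not_mem_succ_of_mem_genSet Ω hjk hsrc) ht

/-- The mirror statement: target in `Γ_j^{(j)}`, source centre off `Ω_{j+1}`. [cite: Balaban1984PropagatorsII, (2.3) p.224; Balaban1988Convergent, (2.2) p.255] -/
theorem mem_lamBondsSeq_of_tgt_mem_genSet (Ω : ℕ → Set (Site P 0)) {k : ℕ} (hk : k ≤ P.m + P.K) {j : ℕ}
    (hΩ : j < k → IsBlockUnion (j + 1) (Ω (j + 1))) {c : PBond P j} (htgt : c.tgt ∈ genSet Ω k j)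
    (hs : j < k → embIter j c.src ∉ Ω (j + 1)) : c ∈ lamBondsSeq Ω k j :=
  mem_lamBondsSeq_of_embIter_not_mem Ω hk hΩ (Or.inr htgt) hs (fun hjk => embIter_not_mem_succ_of_mem_genSet Ω hjk htgt)

/-- ★ **AT `Z`'s MAXIMAL SEQUENCE** (`1 ≤ M₁`, torus divisibility, `k ≤ m + K`): a `j`-bond with an end-point in `𝐁_k(Z)_j = Γ_j^{(j)}` and both end-point centres off `Ω_{j+1}(Z)` (asked for `j < k`)
is a member of `lamBondsSeq (maxDomT M₁ Z) k j`. [cite: Balaban1984PropagatorsII, (2.3) p.224; Balaban1988Convergent, (2.13) pp.256–257] -/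
theorem mem_lamBondsSeq_maxDomT_of_embIter_not_mem {M₁ : ℕ} (hM : 1 ≤ M₁) (Z : Set (Site P 0)) {k : ℕ} (hk : k ≤ P.m + P.K)
    (hdiv : B14.Eq213MaximalDomains.side P.L M₁ k ∣ P.sitesPerDir 0) {j : ℕ} {c : PBond P j} (hc : c ∈ bondsOf ((Bj M₁ Z k : DetSet P) j))
    (hs : j < k → embIter j c.src ∉ maxDomT M₁ Z (j + 1)) (ht : j < k → embIter j c.tgt ∉ maxDomT M₁ Z (j + 1)) :
    c ∈ lamBondsSeq (maxDomT M₁ Z) k j :=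
  mem_lamBondsSeq_of_embIter_not_mem (maxDomT M₁ Z) hk (fun hjk => isBlockUnion_maxDomT hM hdiv (by omega) (by omega) (by omega)) hc hs ht

end Literature.MathematicalPhysics.QuantumFieldTheory.Balaban1983to89.B15DeterminingSetsBEndpoints

end
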